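import Summits.BirchSwinnertonDyer.BirchSwinnertonDyer.Theorems.TwoAdicConverseGoodOrdinaryTwistFamily
import Summits.BirchSwinnertonDyer.BirchSwinnertonDyer.Theorems.ByReductionTypeAtTwoTorsionEulerCharGoodOrdEnd
import Summits.BirchSwinnertonDyer.BirchSwinnertonDyer.Theorems.TwoAdicConverseGoodOrdinaryEisensteinAtZero
import Summits.BirchSwinnertonDyer.BirchSwinnertonDyer.Theses.TwoAdicConverse
import Literature.Uncategorized.OrdPublishedInputsAtTwo
import HarnessLib

/-!
# Route `TwoAdicConverse` (rung S3), item `GoodOrdinaryRankZeroTwoConverse` (stmt-BirchSwinnertonDyer-19218): the bridge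
# «PUB + λ-half ⟹ 19218» does NOT need Greenberg's Thm. 4.1 — the rank-`0` `2`-converse at a good ordinary `2` follows from
# {modularity, Kato 17.4 (1)(2) at `2`} + the λ-half `OrdLambdaHalfAtTwo` (item 19556)

Cell `bsd-2adic` (run/shared/lean/pub/bsd-2adic/), seat `bsd-2adic-conv-1` GEN 33 (director-bsd D-0074 (A) row «find: 19218
`GoodOrdinaryRankZeroTwoConverse` from the K4 halves + …»; `--supports stmt-BirchSwinnertonDyer-19218`).  THEOREMS ONLY — no
definition, no named fact, no instance, no `sorry`.

STATE BEFORE.  Item 19218 is SPLIT into PUB = item 19167 `Literature.Uncategorized.OrdConversePublishedInputsAtTwo` = {modularity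
(`nonempty_modularParametrizationData`) ∧ Kato 17.4 (1)(2) AT `2` (`kato_divisibility_allPrimes W 2`) ∧ Greenberg 1999 Thm. 4.1
parity-free (`Greenberg1999.thm41_charValue_rankZero_anyPrime`, archimedean CAVEAT flag `Gre99-Thm41-at-2-archimedean` at `p = 2`)}
and the λ-crux 19556 `OrdLambdaHalfAtTwo`, glued by item 19557 `GoodOrdinaryRankZeroTwoConverseOfLambdaHalf` (CLOSED,
`goodOrdinaryRankZeroTwoConverseOfLambdaHalf_proof` ∘ conv-1's bridge `TwoAdicTwistConverse.goodOrdinaryRankZeroTwoConverse_of_forall_lam_le`,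
p424885).  That bridge consumed Greenberg's Thm. 4.1 (through `X5.O1.twoAdicEulerCharRankZero_zero_of_greenberg`) for exactly one step:
«`Sel_{2^∞}(E/ℚ)` finite ⟹ `f_X(0) ≠ 0`» (Greenberg, LNM 1716, p. 102).

WHAT IS NEW.  That step is now a KERNEL THEOREM of the tree at EVERY good ordinary prime, `2` included, ANY rational `2`-torsion:
`TorsionEulerChar.constantCoeff_ne_zero_of_finite_selmerGroupPInfty` (seat `bsd-2adic-tower-1` GEN 32, route `ByReductionTypeAtTwo`
= the K4 FORMULA axis, file `Theorems/ByReductionTypeAtTwoTorsionEulerCharGoodOrdEnd.lean`; Mazur control at `2` with torsion +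
the qualitative Euler-characteristic algebra, no named fact).  Plugging it into the S3 bridge:

* §1 `entireLFunction_one_ne_zero_of_finite_selmer_of_eisensteinAtZero_of_modularity` — per curve: modularity +
  the Eisenstein half AT THE TRIVIAL CHARACTER (`f_X(0) ≠ 0 ⇒ L₂(f,α)(0) ≠ 0`) + `Sel_{2^∞}(W/ℚ)` finite ⟹ `L(W,1) ≠ 0`
  (= `entireLFunction_one_ne_zero_of_finite_selmer_of_eisensteinAtZero` of `…GoodOrdinaryEisensteinAtZero.lean` WITHOUT `hGr`, and
  without its `h17`, which only fed `hGr`'s Euler-characteristic door);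
* §2 `analyticRank_eq_zero_of_selmerCorank_eq_zero_of_lam_le_of_kato` — per curve: modularity + Kato 17.4@2 + ONE inequality
  `λ(L₀) ≤ λ(X)` + corank `0` ⟹ `r_an(W) = 0` (= p424885's `analyticRank_eq_zero_of_selmerCorank_eq_zero_of_lam_le` WITHOUT `hGr`);
* §3 ∀-closed, ROUTE DECLS BY NAME: `goodOrdinaryRankZeroTwoConverse_of_forall_lam_le_of_kato`,
  **`goodOrdinaryRankZeroTwoConverse_of_ordLambdaHalfAtTwo_of_kato :
  nonempty_modularParametrizationData → (∀ W f, kato_divisibility_allPrimes W 2) →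
  Theses.TwoAdicConverse.OrdLambdaHalfAtTwo → Theses.TwoAdicConverse.GoodOrdinaryRankZeroTwoConverse`** and the Eisenstein-at-zero
  form `goodOrdinaryRankZeroTwoConverse_of_eisensteinAtZero_of_modularity` — so the closed glue item 19557
  (`GoodOrdinaryRankZeroTwoConverseOfLambdaHalf`) reads PUB only through its first two conjuncts (modularity, Kato 17.4@2):
  Greenberg's Thm. 4.1 is IDLE for S3's good-ordinary rank-`0` branch;
* §4 the ORIGINAL split's glue (item 19168: PUB → `OrdEisensteinHalfAtTwo` (19272) → 19218) needs PUB only through MODULARITY: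
  `goodOrdinaryRankZeroTwoConverse_of_ordEisensteinHalfAtTwo_of_modularity` (the typed Eisenstein half ⇒ its `T = 0` shadow,
  `eisensteinAtZero_of_mainConjectureEisensteinDivisibilityAtTwo` of `…GoodOrdinaryEisensteinAtZero.lean`; no Kato, no Greenberg).
  (The closed glue decls themselves are not re-proved here — `dedup.landed`; the two doors above are the record.)

CONSEQUENCE FOR THE LEDGER (planner's call, recorded not executed): on the S3 side the published inputs of 19218 are TWO
{modularity, Kato 17.4 (1)(2) at `2`}; the flag `Gre99-Thm41-at-2-archimedean` leaves S3's good-ordinary cone (the crux line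
`kato_determinant_greenberg_two` already reads `stub_pub` as `⟨hMod, hKato, -⟩`).  HONEST FRAMING: a RE-WIRING of a closed
glue over a new kernel theorem of the companion route; the crux `OrdLambdaHalfAtTwo` (19556) is research-open and untouched;
item 19218 is NOT closed by this file; BSD is not proved by any of this.  PARTITION (D-0054): none — RANK axis S3 × X5@2 good-ord
(B1·O1); closes none; nothing booked.
-/

set_option linter.dupNamespace false
set_option autoImplicit false

noncomputable section

open scoped Classical MatrixGroups ModularForm
open CongruenceSubgroup WeierstrassCurve Literature.NumberTheory.EllipticCurves
  Literature.NumberTheory.EllipticCurves.ModularForms Literature.NumberTheory.EllipticCurves.Rank1Residual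
  Literature.NumberTheory.EllipticCurves.Rank1Residual.Typed Summit.BirchSwinnertonDyer.Rank1Residual.X1.MuLambda
  Summit.BirchSwinnertonDyer.BirchSwinnertonDyer.Theorems.TorsionEulerChar

namespace Summit.BirchSwinnertonDyer.BirchSwinnertonDyer.Theorems.TwoAdicTwistConverse

/-! ## §1 Per curve: the Eisenstein half at the trivial character suffices — WITHOUT Greenberg's Thm. 4.1 -/

section Curve

variable (W : WeierstrassCurve ℚ) [W.IsElliptic] [W.IsGloballyMinimal]

/-- **`L(E,1) ≠ 0` from a finite `2^∞`-Selmer group, modulo modularity and the Eisenstein half AT THE TRIVIAL CHARACTER only —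
no Greenberg Thm. 4.1, no Kato.**  For `W` globally minimal, good ordinary at `2`: modularity (`hmod`) and (`hE0`) for the cyclotomic data, the newform `f`, every dual datum `D` and generator `f_X` of
`char_Λ X`: `f_X(0) ≠ 0 ⇒ L₂(f,α)(0) ≠ 0`.  If `Sel_{2^∞}(W/ℚ)` is finite then `L(W,1) ≠ 0`: `f_X(0) ≠ 0` is the KERNEL theorem
`TorsionEulerChar.constantCoeff_ne_zero_of_finite_selmerGroupPInfty` (Greenberg p. 102 «`X/TX` finite, hence `T ∤ f_E(T)`», every
good ordinary `p`, `2` included, any rational torsion); then `L₂(f,α)(0) = (1 − α⁻¹)²·[0]⁺_f ≠ 0` and `L(E,1) = [0]⁺_f·Ω⁺_f`, `Ω⁺_f > 0`.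
[cite: GreenbergLNM1716, §4 p. 102 (before Thm. 4.1) and §1 (pp. 65–66)] [cite: MazurTateTeitelbaum1986Invent, §I.14 (14.3)]
[cite: Kato2004Asterisque, Thm. 17.4 (1) (p. 273)] -/
theorem entireLFunction_one_ne_zero_of_finite_selmer_of_eisensteinAtZero_of_modularity
    (hmod : nonempty_modularParametrizationData) (hgo : GoodOrd W 2)
    (hE0 : ∀ (κ : ZpExtension ℚ 2) (γ : Field.absoluteGaloisGroup ℚ),
      κ.IsCyclotomic → κ.IsTopGenerator γ → IsCyclotomicVariable 2 γ → IsOrdinaryAt W 2 →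
      ∀ [NeZero (W.conductorNorm ℤ)] (f : CuspForm (Gamma0 (W.conductorNorm ℤ)) 2),
        IsNewformOf W f → ∀ (D : W.SelmerDualData κ γ) (fE : IwasawaAlgebra 2),
          D.charIdeal = Ideal.span {fE} → PowerSeries.constantCoeff fE ≠ 0 →
            PowerSeries.constantCoeff (padicLFunction f (unitRoot W 2 : ℚ_[2])) ≠ 0)
    (hSel : Finite (W.selmerGroupPInfty 2)) : W.entireLFunction 1 ≠ 0 := by
  have hord : IsOrdinaryAt W 2 := hgo
  haveI : NeZero (W.conductorNorm ℤ) := ⟨(W.conductorNorm_pos_holds).ne'⟩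
  obtain ⟨Dm⟩ := hmod W
  have hf : IsNewformOf W Dm.f := Dm.isNewformOf
  obtain ⟨κ, hκ, γ, hγ, hγ'⟩ := exists_isCyclotomic_isTopGenerator_isCyclotomicVariable_holds 2
  obtain ⟨D⟩ := W.nonempty_selmerDualData_holds κ γ hγ
  obtain ⟨fE, hfE⟩ := (charIdeal_isPrincipal_holds 2 D.X).principal
  have hchar : D.charIdeal = Ideal.span {fE} := hfE
  haveI := hSel
  -- Greenberg p. 102 AT `2`, KERNEL (tower-1 GEN 32): `f_X(0) ≠ 0`
  have hfE0' : PowerSeries.constantCoeff fE ≠ 0 :=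
    TorsionEulerChar.constantCoeff_ne_zero_of_finite_selmerGroupPInfty 2 W hgo κ hκ hγ D fE hchar
  -- the Eisenstein half at the trivial character: `L₂(f,α)(0) ≠ 0`
  have hL0 : PowerSeries.constantCoeff (padicLFunction Dm.f (unitRoot W 2 : ℚ_[2])) ≠ 0 :=
    hE0 κ γ hκ hγ hγ' hord Dm.f hf D fE hchar hfE0'
  -- interpolation: `L₂(f,α)(0) = (1 - α⁻¹)² · [0]⁺_f`
  rw [constantCoeff_padicLFunction_unitRoot hord hf] at hL0
  have hs0 : ratPlusSymbol Dm.f 0 ≠ 0 := by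
    intro hs
    apply hL0
    rw [hs, Rat.cast_zero, mul_zero]
  -- `L(E,1) = [0]⁺_f · Ω⁺_f`, `Ω⁺_f > 0`
  have hper : 0 < plusPeriod Dm.f := IsNewform0.plusPeriod_pos_holds hf.1 hf.coeffField_eq_bot
  rw [hf.entireLFunction_one_eq]
  have hre : ((ratPlusSymbol Dm.f 0 : ℚ) : ℝ) * plusPeriod Dm.f ≠ 0 :=
    mul_ne_zero (by exact_mod_cast hs0) hper.ne'
  exact_mod_cast hre

/-! ## §2 Per curve: `λ_an ≤ λ_alg` suffices — WITHOUT Greenberg's Thm. 4.1 -/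

/-- **THE CONVERSE AT `W` FROM `λ_an ≤ λ_alg`, modulo {modularity, Kato 17.4 (1)(2)@2} only.**  `W` globally minimal, good ordinary at
`2`; modularity (`hmod`), Kato 17.4 (1)(2)@2 (`h17`); and (`hΛ`) for the cyclotomic data, the newform `f` and every dual datum `D`: SOME
nonzero integral rational multiple `L₀ ∈ Λ` of `L₂(f,α)` has `λ(L₀) ≤ λ(X)`.  Then `corank_{ℤ₂} Sel_{2^∞}(W/ℚ) = 0 ⇒ r_an(W) = 0`:
the pinch at `T = 0` (`constantCoeff_charGen_eq_zero_iff_of_lam_le`, p424885 §1–§2: Kato's divisibility pulled back to `Λ` and the one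
inequality give `f_X(0) = 0 ⟺ L₀(0) = 0`) turns `hΛ` into the Eisenstein half at the trivial character, and §1 concludes.  = p424885's
`analyticRank_eq_zero_of_selmerCorank_eq_zero_of_lam_le` with the binder `hGr : Greenberg1999.thm41_charValue_rankZero_anyPrime` REMOVED.
[cite: GreenbergLNM1716, §4 p. 102 and §1 (pp. 65–66)] [cite: MazurTateTeitelbaum1986Invent, §I.14 (14.3)]
[cite: Kato2004Asterisque, Thm. 17.4 (1)(2) (p. 273)] [cite: GreenbergVatsal2000, p. 4 (after Thm. (1.2))] -/
theorem analyticRank_eq_zero_of_selmerCorank_eq_zero_of_lam_le_of_kato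
    (hmod : nonempty_modularParametrizationData)
    (h17 : ∀ [NeZero (W.conductorNorm ℤ)] (f : CuspForm (Gamma0 (W.conductorNorm ℤ)) 2),
      kato_divisibility_allPrimes W 2 (f := f))
    (hgo : GoodOrd W 2)
    (hΛ : ∀ (κ : ZpExtension ℚ 2) (γ : Field.absoluteGaloisGroup ℚ),
      κ.IsCyclotomic → κ.IsTopGenerator γ → IsCyclotomicVariable 2 γ →
      ∀ [NeZero (W.conductorNorm ℤ)] (f : CuspForm (Gamma0 (W.conductorNorm ℤ)) 2), IsNewformOf W f →
      ∀ (D : W.SelmerDualData κ γ), ∃ (c : ℚ) (L₀ : IwasawaAlgebra 2), L₀ ≠ 0 ∧ iwasawaToPowerSeries 2 L₀ =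
          PowerSeries.C (c : ℚ_[2]) * padicLFunction f (unitRoot W 2 : ℚ_[2]) ∧ lam L₀ ≤ D.lambda)
    (hsel : W.selmerCorank 2 = 0) : W.analyticRank = 0 := by
  have hSel : Finite (W.selmerGroupPInfty 2) :=
    (finite_selmerGroupPInfty_iff_selmerCorank_eq_zero W 2).2 hsel
  refine analyticRank_eq_zero_of_entireLFunction_one_ne_zero W
    (entireLFunction_one_ne_zero_of_finite_selmer_of_eisensteinAtZero_of_modularity W hmod hgo ?_ hSel)
  -- the λ-datum at `W` and the pinch at `T = 0`: `f_X(0) ≠ 0 ⇒ L₀(0) ≠ 0 ⇒ L₂(f,α)(0) ≠ 0`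
  intro κ γ hκ hγ hγ' hord _ f hf D fE hchar hfE0
  obtain ⟨c, L₀, hL₀0, hL₀, hlam⟩ := hΛ κ γ hκ hγ hγ' f hf D
  have hL00 : PowerSeries.constantCoeff L₀ ≠ 0 := fun h0 =>
    hfE0 ((constantCoeff_charGen_eq_zero_iff_of_lam_le W (h17 f) hκ hγ hγ' hord hf D hchar hL₀0 hL₀ hlam).mpr h0)
  intro h0
  apply hL00
  have h1 := congrArg PowerSeries.constantCoeff hL₀
  rw [constantCoeff_iwasawaToPowerSeries 2 L₀, map_mul, PowerSeries.constantCoeff_C, h0, mul_zero] at h1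
  exact (PadicInt.coe_eq_zero).mp h1

end Curve

/-! ## §3 ∀-closed, route decls BY NAME -/

open Summit.BirchSwinnertonDyer.BirchSwinnertonDyer.Theses.TwoAdicConverse (GoodOrdinaryRankZeroTwoConverse OrdEisensteinHalfAtTwo)

/-- **19218 from modularity + the Eisenstein half at the trivial character on the finite-`Sel` locus** — the `hGr`-free (and
Kato-free) form of `goodOrdinaryRankZeroTwoConverse_of_eisensteinAtZero`. [cite: GreenbergLNM1716, §4 p. 102]
[cite: MazurTateTeitelbaum1986Invent, §I.14 (14.3)] [cite: Kato2004Asterisque, Thm. 17.4 (1) (p. 273)] -/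
theorem goodOrdinaryRankZeroTwoConverse_of_eisensteinAtZero_of_modularity
    (hmod : nonempty_modularParametrizationData)
    (hE0 : ∀ (W : WeierstrassCurve ℚ) [W.IsElliptic] [W.IsGloballyMinimal], ¬ W.HasCM → GoodOrd W 2 →
      Finite (W.selmerGroupPInfty 2) →
      ∀ (κ : ZpExtension ℚ 2) (γ : Field.absoluteGaloisGroup ℚ),
        κ.IsCyclotomic → κ.IsTopGenerator γ → IsCyclotomicVariable 2 γ → IsOrdinaryAt W 2 →
        ∀ [NeZero (W.conductorNorm ℤ)] (f : CuspForm (Gamma0 (W.conductorNorm ℤ)) 2),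
          IsNewformOf W f → ∀ (D : W.SelmerDualData κ γ) (fE : IwasawaAlgebra 2),
            D.charIdeal = Ideal.span {fE} → PowerSeries.constantCoeff fE ≠ 0 →
              PowerSeries.constantCoeff (padicLFunction f (unitRoot W 2 : ℚ_[2])) ≠ 0) :
    GoodOrdinaryRankZeroTwoConverse := by
  unfold GoodOrdinaryRankZeroTwoConverse
  intro W _ _ hcm hgo hsel
  have hSel : Finite (W.selmerGroupPInfty 2) :=
    (finite_selmerGroupPInfty_iff_selmerCorank_eq_zero W 2).2 hsel
  exact analyticRank_eq_zero_of_entireLFunction_one_ne_zero W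
    (entireLFunction_one_ne_zero_of_finite_selmer_of_eisensteinAtZero_of_modularity W hmod hgo (hE0 W hcm hgo hSel) hSel)

/-- **19218 from {modularity, Kato 17.4 (1)(2)@2} + the class-wide λ-half, ∀-closed** — the `hGr`-free form of p424885's
`goodOrdinaryRankZeroTwoConverse_of_forall_lam_le`: for every NON-CM globally minimal `W` good ordinary at `2`, its cyclotomic data,
newform and dual data, some nonzero integral rational multiple `L₀` of `L₂(f,α)` has `λ(L₀) ≤ λ(X(W/ℚ_∞))` (`hΛ`) ⟹
`GoodOrdinaryRankZeroTwoConverse`.  A REDUCTION; `hΛ` is not in print at `p = 2`. [cite: GreenbergVatsal2000, p. 4 (after Thm. (1.2))]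
[cite: Kato2004Asterisque, Thm. 17.4 (1)(2) (p. 273)] [cite: GreenbergLNM1716, §4 p. 102] -/
theorem goodOrdinaryRankZeroTwoConverse_of_forall_lam_le_of_kato
    (hmod : nonempty_modularParametrizationData)
    (h17 : ∀ (W : WeierstrassCurve ℚ) [W.IsElliptic] [W.IsGloballyMinimal] [NeZero (W.conductorNorm ℤ)]
      (f : CuspForm (Gamma0 (W.conductorNorm ℤ)) 2), kato_divisibility_allPrimes W 2 (f := f))
    (hΛ : ∀ (W : WeierstrassCurve ℚ) [W.IsElliptic] [W.IsGloballyMinimal], ¬ W.HasCM → GoodOrd W 2 →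
      ∀ (κ : ZpExtension ℚ 2) (γ : Field.absoluteGaloisGroup ℚ),
      κ.IsCyclotomic → κ.IsTopGenerator γ → IsCyclotomicVariable 2 γ →
      ∀ [NeZero (W.conductorNorm ℤ)] (f : CuspForm (Gamma0 (W.conductorNorm ℤ)) 2), IsNewformOf W f →
      ∀ (D : W.SelmerDualData κ γ), ∃ (c : ℚ) (L₀ : IwasawaAlgebra 2), L₀ ≠ 0 ∧ iwasawaToPowerSeries 2 L₀ =
          PowerSeries.C (c : ℚ_[2]) * padicLFunction f (unitRoot W 2 : ℚ_[2]) ∧ lam L₀ ≤ D.lambda) :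
    GoodOrdinaryRankZeroTwoConverse := by
  unfold GoodOrdinaryRankZeroTwoConverse
  intro W _ _ hcm hgo hsel
  exact analyticRank_eq_zero_of_selmerCorank_eq_zero_of_lam_le_of_kato W hmod (fun f => h17 W f) hgo (hΛ W hcm hgo) hsel

/-- **THE RE-WIRED GLUE, BY NAME: {modularity, Kato 17.4 (1)(2)@2} + `OrdLambdaHalfAtTwo` (item 19556, route decl) ⟹
`GoodOrdinaryRankZeroTwoConverse` (item 19218, route decl)** — Greenberg's Thm. 4.1 is not an input.  The route decl's ordinary
guard is discharged by `GoodOrd W 2` (as in `goodOrdinaryRankZeroTwoConverse_of_ordLambdaHalfAtTwo`, p427789).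
[cite: GreenbergVatsal2000, p. 4 (after Thm. (1.2))] [cite: Kato2004Asterisque, Thm. 17.4 (1)(2) (p. 273)] [cite: GreenbergLNM1716, §4 p. 102] -/
theorem goodOrdinaryRankZeroTwoConverse_of_ordLambdaHalfAtTwo_of_kato
    (hmod : nonempty_modularParametrizationData)
    (h17 : ∀ (W : WeierstrassCurve ℚ) [W.IsElliptic] [W.IsGloballyMinimal] [NeZero (W.conductorNorm ℤ)]
      (f : CuspForm (Gamma0 (W.conductorNorm ℤ)) 2), kato_divisibility_allPrimes W 2 (f := f))
    (hL : Summit.BirchSwinnertonDyer.BirchSwinnertonDyer.Theses.TwoAdicConverse.OrdLambdaHalfAtTwo) :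
    GoodOrdinaryRankZeroTwoConverse :=
  goodOrdinaryRankZeroTwoConverse_of_forall_lam_le_of_kato hmod h17
    (fun W _ _ hcm hgo κ γ hκ hγ hγ' _ f hf D => hL W hcm hgo κ γ hκ hγ hγ' hgo f hf D)

/-! ## §4 The original split's glue (item 19168) needs PUB only through MODULARITY -/

/-- **19218 from modularity + the Eisenstein half `OrdEisensteinHalfAtTwo` (item 19272, now K4's crux; route decl BY NAME)** — no Kato,
no Greenberg: the typed Eisenstein half gives its `T = 0` shadow (`eisensteinAtZero_of_mainConjectureEisensteinDivisibilityAtTwo`, constant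
terms of `ι f_X = ι h · ϖ·L₂(f,α)`), and §3's modularity-only door concludes. [cite: SkinnerUrban2014, Conj. 3.6.8 (p. 45) (shape; p odd)]
[cite: MazurTateTeitelbaum1986Invent, §I.14 (14.3)] [cite: GreenbergLNM1716, §4 p. 102] -/
theorem goodOrdinaryRankZeroTwoConverse_of_ordEisensteinHalfAtTwo_of_modularity
    (hmod : nonempty_modularParametrizationData) (hE : OrdEisensteinHalfAtTwo) :
    GoodOrdinaryRankZeroTwoConverse :=
  goodOrdinaryRankZeroTwoConverse_of_eisensteinAtZero_of_modularity hmod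
    (fun W _ _ hcm hgo _ => eisensteinAtZero_of_mainConjectureEisensteinDivisibilityAtTwo W hmod (hE W hcm hgo))

end Summit.BirchSwinnertonDyer.BirchSwinnertonDyer.Theorems.TwoAdicTwistConverse

end
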